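import Mathlib
import HarnessLib
import Summits.Ventures.LatticeQCDFlow.Exactness.NCMCGeneralSpaceEventTauIntFloor
import Summits.Ventures.LatticeQCDFlow.Exactness.NCMCGeneralSpaceOccupancyChainCLTHeatBath
import Summits.Ventures.LatticeQCDFlow.Exactness.NCMCGeneralSpaceOccupancyChainErrorBars
import Summits.Ventures.LatticeQCDFlow.Exactness.NCMCGeneralSpaceGammaCoverageUnconditional

/-!
# The NCMC lane's `τ_int(ρ_occ)` from the two-step certificate ALONE: the explicit floor `min(sin²(πσ), e/4)/(8π² σ(1 − σ))`, and END-TO-END positivity for the heat-bath shape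

HONEST FRAMING: exact (Metropolis-corrected) sampling algorithms for lattice gauge theory;
figures of merit are autocorrelation/cost numbers at stated couplings and volumes; no
continuum-physics claim.

Venture `LatticeQCDFlow` (cell pub-lqcd), topic `Exactness`; FANOUT row 13 (`eng-snf`, GEN-21).
NEW WORK of the cell, not a published result; no definition is introduced; nothing is cited as a
fact.  Corollaries of GEN-21's event floor `NCMCGeneralSpaceEventTauIntFloor.tauInt_setACF_ge_of_nHit`
for the engine's iteration kernel `Q = switchKernel κF κR c W s e ∘ₖ levelKernel T₀ T₁` and its
occupancy `ρ_occ = setACF Q π_c target` (`σ = σ(c − ΔF) = π_c(target)`):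
GEN-21's `NCMCGeneralSpaceOccupancyTauIntLowerBound` gives `σ ρ₀²/(2(1 + ρ₀))` from the STRUCTURE of the
certificate (prior-level regeneration); THIS file gives `min(sin²(πσ), e/4)/(8π² σ(1 − σ))` from the
bare inequality `ε • ν ≤ (nHit Q 2)(z, ·)` — whatever produced it — and the qualitative positivity for
the existential certificate, hence END TO END for the heat-bath (OBC / defect) shape.

## Content

* **`tauInt_setACF_mem_Icc_of_nHit`** — THE SANDWICH for every event under a Doeblin power:
  `min(sin²(πp), e/m²)/(8π² p(1−p)) ≤ τ_int(setACF κ π A) ≤ 1/2 + (m/e − 1)/(1 − p)` (GEN-21's floor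
  and GEN-18's ceiling `tauInt_setACF_le_of_nHit`): the fitness `τ_int` of every sector indicator lies
  in an explicit interval determined by the certificate `(ε, m)` and `p = π(A)` alone.
* **`CrooksPair.ncmc_tauInt_occupancy_floor_of_sq`** — Crooks pair, `T₀, T₁` leaving `ν₀, ν₁` invariant,
  `ε • ν ≤ (nHit Q 2)(z, ·)` (`ε ≠ 0`), `e^{−ΔF} = Z₁/Z₀`:
  `min (sin²(π σ)) (ε.toReal/4) / (8 π² σ (1 − σ)) ≤ τ_int(ρ_occ)`.
* **`CrooksPair.ncmc_tauInt_occupancy_mem_Icc_of_sq`** — the lane's sandwich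
  `min(sin²(πσ), e/4)/(8π²σ(1−σ)) ≤ τ_int(ρ_occ) ≤ 1/2 + (2/e − 1)/(1 − σ)`.
* **`CrooksPair.ncmc_tauInt_occupancy_pos_of_exists_sq`** — `0 < τ_int(ρ_occ)` from the EXISTENTIAL
  certificate.
* **`CrooksPair.ncmc_heatBath_tauInt_occupancy_pos_of_ne`** — END TO END: two bounded densities,
  heat-bath scans visiting every site between switches, ANY Crooks pair, every `c ≠ ΔF`:
  `0 < τ_int(ρ_occ)`.

NOT CLAIMED: the value of `ε` for the heat-bath shape (astronomically small; the figure of merit is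
MEASURED); anything at `c = ΔF` with `W ≡ ΔF`.
-/

namespace Summit.Ventures.LatticeQCDFlow.Exactness.GeneralNCMC

open MeasureTheory ProbabilityTheory Set Filter Finset
open scoped ENNReal NNReal Topology

/-! ## §0 The sandwich for events under a Doeblin power -/

section Event

variable {S : Type*} [MeasurableSpace S]
  {κ : Kernel S S} [IsMarkovKernel κ] {π : Measure S} [IsProbabilityMeasure π]
  {ν : Measure S} [IsProbabilityMeasure ν] {ε : ℝ≥0∞} {m : ℕ}

/-- **THE SANDWICH: every event's `τ_int` lies in an explicit interval determined by the Doeblin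
certificate.**  `κ` Markov, `π` invariant, `ε • ν ≤ (nHit κ m)(z, ·)` for all `z` (`ε ≠ 0`, `0 < m`),
`A` measurable with `0 < p = π(A) < 1`, `e = ε.toReal`:
`min(sin²(πp), e/m²)/(8π² p(1−p)) ≤ Scoring.tauInt (setACF κ π A) ≤ 1/2 + (m/e − 1)/(1 − p)`. -/
theorem tauInt_setACF_mem_Icc_of_nHit (hπ : Kernel.Invariant κ π) (hε : ε ≠ 0)
    (hmin : ∀ z, ε • ν ≤ nHit κ m z) (hm : 0 < m) {A : Set S} (hA : MeasurableSet A)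
    (h0 : 0 < π.real A) (h1 : π.real A < 1) :
    Scoring.tauInt (setACF κ π A) ∈ Set.Icc
      (min (Real.sin (Real.pi * π.real A) ^ 2) (ε.toReal / (m : ℝ) ^ 2)
        / (8 * Real.pi ^ 2 * (π.real A * (1 - π.real A))))
      (1 / 2 + (m / ε.toReal - 1) / (1 - π.real A)) := by
  haveI : Nonempty S := nonempty_of_isProbabilityMeasure π
  have hε1 : ε ≤ 1 := by
    haveI := isMarkovKernel_nHit κ m
    exact eps_le_one_of_minorised hmin
  have hε0 : 0 < ε := pos_iff_ne_zero.2 hε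
  have hminS : ∀ x {B : Set S}, MeasurableSet B → ε * ν B ≤ nHit κ m x B :=
    fun z B hB => minorised_setwise hmin z hB
  exact ⟨tauInt_setACF_ge_of_nHit hπ hε hmin hm hA h0 h1,
    tauInt_setACF_le_of_nHit hminS hε0 hε1 hm hπ hA h0 h1⟩

end Event

/-! ## §1 From the two-step certificate -/

section NCMC

variable {Ω E : Type*} [MeasurableSpace Ω] [MeasurableSpace E]
  {ν₀ ν₁ : Measure Ω} [IsFiniteMeasure ν₀] [IsFiniteMeasure ν₁]
  {κF κR : Kernel Ω E} [IsMarkovKernel κF] [IsMarkovKernel κR] {s e : E → Ω} {W : E → ℝ} {c : ℝ}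
  {T₀ T₁ : Kernel Ω Ω} [IsMarkovKernel T₀] [IsMarkovKernel T₁] {ε : ℝ≥0∞}
  {ν : Measure (Bool × Ω)} [IsProbabilityMeasure ν]

/-- **THE EXPLICIT FLOOR FOR THE LANE FROM THE BARE TWO-STEP CERTIFICATE**: with
`σ = σ(c − ΔF)`, `min (sin²(π σ)) (ε.toReal / 4) / (8 π² σ (1 − σ)) ≤ τ_int(ρ_occ)`. -/
theorem CrooksPair.ncmc_tauInt_occupancy_floor_of_sq (h : CrooksPair ν₀ ν₁ κF κR s e W)
    (h0 : ν₀ univ ≠ 0) (h1 : ν₁ univ ≠ 0) (hT₀ : Kernel.Invariant T₀ ν₀)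
    (hT₁ : Kernel.Invariant T₁ ν₁) (hε : ε ≠ 0)
    (hD : haveI := isMarkovKernel_switchKernel (κF := κF) (κR := κR) (c := c)
              h.measurable_W h.measurable_s h.measurable_e
      ∀ z, ε • ν ≤ nHit (switchKernel κF κR c W s e ∘ₖ levelKernel T₀ T₁) 2 z)
    {ΔF : ℝ} (hΔF : Real.exp (-ΔF) = ((ν₀ univ)⁻¹ * ν₁ univ).toReal) :
    haveI := isMarkovKernel_switchKernel (κF := κF) (κR := κR) (c := c)
      h.measurable_W h.measurable_s h.measurable_e
    min (Real.sin (Real.pi * Real.sigmoid (c - ΔF)) ^ 2) (ε.toReal / 4)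
        / (8 * Real.pi ^ 2 * (Real.sigmoid (c - ΔF) * (1 - Real.sigmoid (c - ΔF))))
      ≤ Scoring.tauInt (setACF (switchKernel κF κR c W s e ∘ₖ levelKernel T₀ T₁)
          ((jointWeight c ν₀ ν₁ univ)⁻¹ • jointWeight c ν₀ ν₁) (targetLevel Ω)) := by
  haveI := isMarkovKernel_switchKernel (κF := κF) (κR := κR) (c := c)
    h.measurable_W h.measurable_s h.measurable_e
  haveI := isMarkovKernel_levelKernel T₀ T₁
  haveI := isProbabilityMeasure_jointLaw c ν₀ ν₁ h0
  have hπ : Kernel.Invariant (switchKernel κF κR c W s e ∘ₖ levelKernel T₀ T₁)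
      ((jointWeight c ν₀ ν₁ univ)⁻¹ • jointWeight c ν₀ ν₁) :=
    invariant_smul _ (iteration_invariant h hT₀ hT₁ c) _
  have hσeq := jointLaw_real_targetLevel c ν₀ ν₁ h0 h1 hΔF
  have hp0 : 0 < ((jointWeight c ν₀ ν₁ univ)⁻¹ • jointWeight c ν₀ ν₁).real (targetLevel Ω) := by
    rw [hσeq]; exact Real.sigmoid_pos _
  have hp1 : ((jointWeight c ν₀ ν₁ univ)⁻¹ • jointWeight c ν₀ ν₁).real (targetLevel Ω) < 1 := by
    rw [hσeq]; exact Real.sigmoid_lt_one _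
  have hmain := tauInt_setACF_ge_of_nHit hπ hε hD (by norm_num : 0 < 2) measurableSet_targetLevel hp0 hp1
  rw [hσeq] at hmain
  have h4 : ((2 : ℕ) : ℝ) ^ 2 = 4 := by norm_num
  rw [h4] at hmain
  exact hmain

/-- **The lane's sandwich**: `min(sin²(πσ), e/4)/(8π²σ(1−σ)) ≤ τ_int(ρ_occ) ≤ 1/2 + (2/e − 1)/(1 − σ)`
(GEN-21's floor and GEN-18's ceiling `CrooksPair.ncmc_tauInt_occupancy_le_of_sq`). -/
theorem CrooksPair.ncmc_tauInt_occupancy_mem_Icc_of_sq (h : CrooksPair ν₀ ν₁ κF κR s e W)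
    (h0 : ν₀ univ ≠ 0) (h1 : ν₁ univ ≠ 0) (hT₀ : Kernel.Invariant T₀ ν₀)
    (hT₁ : Kernel.Invariant T₁ ν₁) (hε : ε ≠ 0)
    (hD : haveI := isMarkovKernel_switchKernel (κF := κF) (κR := κR) (c := c)
              h.measurable_W h.measurable_s h.measurable_e
      ∀ z, ε • ν ≤ nHit (switchKernel κF κR c W s e ∘ₖ levelKernel T₀ T₁) 2 z)
    {ΔF : ℝ} (hΔF : Real.exp (-ΔF) = ((ν₀ univ)⁻¹ * ν₁ univ).toReal) :
    haveI := isMarkovKernel_switchKernel (κF := κF) (κR := κR) (c := c)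
      h.measurable_W h.measurable_s h.measurable_e
    Scoring.tauInt (setACF (switchKernel κF κR c W s e ∘ₖ levelKernel T₀ T₁)
        ((jointWeight c ν₀ ν₁ univ)⁻¹ • jointWeight c ν₀ ν₁) (targetLevel Ω))
      ∈ Set.Icc (min (Real.sin (Real.pi * Real.sigmoid (c - ΔF)) ^ 2) (ε.toReal / 4)
          / (8 * Real.pi ^ 2 * (Real.sigmoid (c - ΔF) * (1 - Real.sigmoid (c - ΔF)))))
        (1 / 2 + (2 / ε.toReal - 1) / (1 - Real.sigmoid (c - ΔF))) :=
  ⟨h.ncmc_tauInt_occupancy_floor_of_sq h0 h1 hT₀ hT₁ hε hD hΔF,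
    h.ncmc_tauInt_occupancy_le_of_sq h0 h1 hT₀ hT₁ hε hD hΔF⟩

omit [IsProbabilityMeasure ν] in
/-- **Positivity of the lane's `τ_int(ρ_occ)` from the EXISTENTIAL two-step certificate.** -/
theorem CrooksPair.ncmc_tauInt_occupancy_pos_of_exists_sq (h : CrooksPair ν₀ ν₁ κF κR s e W)
    (h0 : ν₀ univ ≠ 0) (h1 : ν₁ univ ≠ 0) (hT₀ : Kernel.Invariant T₀ ν₀)
    (hT₁ : Kernel.Invariant T₁ ν₁)
    (hex : ∃ (ε : ℝ≥0∞) (ν : Measure (Bool × Ω)), IsProbabilityMeasure ν ∧ ε ≠ 0 ∧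
      ∀ z, ε • ν ≤ nHit (switchKernel κF κR c W s e ∘ₖ levelKernel T₀ T₁) 2 z)
    {ΔF : ℝ} (hΔF : Real.exp (-ΔF) = ((ν₀ univ)⁻¹ * ν₁ univ).toReal) :
    haveI := isMarkovKernel_switchKernel (κF := κF) (κR := κR) (c := c)
      h.measurable_W h.measurable_s h.measurable_e
    0 < Scoring.tauInt (setACF (switchKernel κF κR c W s e ∘ₖ levelKernel T₀ T₁)
        ((jointWeight c ν₀ ν₁ univ)⁻¹ • jointWeight c ν₀ ν₁) (targetLevel Ω)) := by
  obtain ⟨ε, ν, hν, hε, hD⟩ := hex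
  haveI := hν
  exact h.ncmc_tauInt_occupancy_pos_of_sq h0 h1 hT₀ hT₁ hε hD hΔF

end NCMC

/-! ## §2 END TO END for the heat-bath shape -/

section HeatBath

variable {ι : Type*} [Fintype ι] [DecidableEq ι] {X : ι → Type*} [∀ i, MeasurableSpace (X i)]
variable {μ : Π i, Measure (X i)} [∀ i, IsProbabilityMeasure (μ i)]

/-- **END TO END, HEAT-BATH SHAPE: `τ_int(ρ_occ) > 0` FOR EVERY `c ≠ ΔF`.**  Prior `p₀ · ⊗μ`, target
`p₁ · ⊗μ` (`0 < m_k ≤ p_k ≤ M_k < ∞`), heat-bath scans over lists visiting every site between switches,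
ANY Crooks pair, `e^{−ΔF} = Z₁/Z₀`, `c ≠ ΔF`: the integrated autocorrelation time of the occupancy of
the target level is positive — the last assumed hypothesis of the lane's exact-coverage theorems holds
for the engine's own shape. -/
theorem CrooksPair.ncmc_heatBath_tauInt_occupancy_pos_of_ne {p₀ p₁ : (Π j, X j) → ℝ≥0∞}
    {m₀ M₀ m₁ M₁ : ℝ≥0∞}
    (hp₀ : Measurable p₀) (hm₀0 : m₀ ≠ 0) (hM₀ : M₀ ≠ ∞) (hmp₀ : ∀ ω, m₀ ≤ p₀ ω)
    (hpM₀ : ∀ ω, p₀ ω ≤ M₀) {l₀ : List ι} (hl₀ : ∀ i, i ∈ l₀)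
    (hp₁ : Measurable p₁) (hm₁0 : m₁ ≠ 0) (hM₁ : M₁ ≠ ∞) (hmp₁ : ∀ ω, m₁ ≤ p₁ ω)
    (hpM₁ : ∀ ω, p₁ ω ≤ M₁) {l₁ : List ι} (hl₁ : ∀ i, i ∈ l₁)
    {E : Type*} [MeasurableSpace E] {κF κR : Kernel (Π j, X j) E} [IsMarkovKernel κF]
    [IsMarkovKernel κR] {s e : E → (Π j, X j)} {W : E → ℝ}
    (h : CrooksPair ((Measure.pi μ).withDensity p₀) ((Measure.pi μ).withDensity p₁) κF κR s e W)
    {c ΔF : ℝ}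
    (hΔF : Real.exp (-ΔF) = ((((Measure.pi μ).withDensity p₀) univ)⁻¹ *
      ((Measure.pi μ).withDensity p₁) univ).toReal) (hc : c ≠ ΔF) :
    ∃ (_ : IsMarkovKernel (switchKernel κF κR c W s e)),
      0 < Scoring.tauInt (setACF (switchKernel κF κR c W s e ∘ₖ
          levelKernel (cycle (l₀.map (siteHeatBath μ p₀))) (cycle (l₁.map (siteHeatBath μ p₁))))
        ((jointWeight c ((Measure.pi μ).withDensity p₀) ((Measure.pi μ).withDensity p₁) univ)⁻¹ •
          jointWeight c ((Measure.pi μ).withDensity p₀) ((Measure.pi μ).withDensity p₁))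
        (targetLevel (Π j, X j))) := by
  obtain ⟨hMk₀, hfin₀, -, -, h0, -, hK₀, -⟩ := heatBathSweep_package (μ := μ) hp₀ hm₀0
    hM₀ hmp₀ hpM₀ hl₀
  obtain ⟨hMk₁, hfin₁, -, -, h1, -, hK₁, -⟩ := heatBathSweep_package (μ := μ) hp₁ hm₁0
    hM₁ hmp₁ hpM₁ hl₁
  obtain ⟨hmfin₀, hm₀, hmin₀, hac₀⟩ := heatBath_minorising (μ := μ) hp₀ hm₀0 hM₀ hmp₀ hpM₀ hl₀
  obtain ⟨hmfin₁, hm₁, hmin₁, hac₁⟩ := heatBath_minorising (μ := μ) hp₁ hm₁0 hM₁ hmp₁ hpM₁ hl₁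
  haveI := hMk₀
  haveI := hMk₁
  haveI := hfin₀
  haveI := hfin₁
  haveI := hmfin₀
  haveI := hmfin₁
  exact ⟨isMarkovKernel_switchKernel (κF := κF) (κR := κR) (c := c)
      h.measurable_W h.measurable_s h.measurable_e,
    h.ncmc_tauInt_occupancy_pos_of_exists_sq h0 h1 hK₀ hK₁
      (h.ncmc_exists_sq_doeblin hm₀ hm₁ hmin₀ hmin₁ hac₀ hac₁ c
        (h.bind_work_ne_ne_zero_of_ne h0 hΔF hc)) hΔF⟩

end HeatBath

end Summit.Ventures.LatticeQCDFlow.Exactness.GeneralNCMC
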